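/-
Copyright (c) 2026. All rights reserved.
Released under Apache 2.0 license as described in the file LICENSE.
Authors: hodgecm-mathlib cell (D-0151), fan A, seat A-p10.
-/
import Mathlib.LinearAlgebra.Dual.Lemmas
import Mathlib.LinearAlgebra.Basis.Fin
import Mathlib.LinearAlgebra.FiniteDimensional.Lemmas
import Mathlib.LinearAlgebra.Matrix.GeneralLinearGroup.Defs
import Mathlib.LinearAlgebra.Matrix.ToLin
import HarnessLib

/-!
# `GL_N(K)` is transitive on the level sets `{(x, y) : x ⬝ᵥ y = b, x ≠ 0, y ≠ 0}` of the split pairing (`N ≥ 2`, any field)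

Topic `NumberTheory/Automorphic`; namespace `Literature.NumberTheory.Automorphic.GLnDotProduct`.  KERNEL ONLY: theorems; no
definition, no named fact, no instance, no `sorry`.

THE STATEMENT.  For a field `K` and a finite index type `n` with `2 ≤ |n|`, the group `GL n K` acts on `Kⁿ × Kⁿ` by
`g · (x, y) := (g *ᵥ x, (g⁻¹)ᵀ *ᵥ y)`; this preserves the pairing `x ⬝ᵥ y` (`dotProduct_mulVec_transpose_inv_mulVec`) and is
TRANSITIVE on every level set `{(x, y) | x ⬝ᵥ y = b, x ≠ 0, y ≠ 0}`, `b ∈ K` — the value `b = 0` included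
(**`exists_gl_mulVec_eq_and_transpose_inv_mulVec_eq`**).  Coordinate-free core (§1): for a finite-dimensional `K`-space `V`
with `2 ≤ dim V`, `GL(V)` acting on `V × V^*` by `(v, φ) ↦ (g v, φ ∘ g⁻¹)` is transitive on `{(v, φ) | φ v = b, v ≠ 0, φ ≠ 0}`
(**`exists_linearEquiv_apply_eq_and_dual_comp_eq`**): both points admit bases of the same SHAPE — if `b ≠ 0`, a basis with
`B 0 = v` and `B i ∈ ker φ` for `i ≥ 1` (Mathlib `Module.Basis.mkFinCons` over a basis of the hyperplane `ker φ`); if `b = 0`, a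
basis with `φ (B 0) = 1`, `B 1 = v`, `B i ∈ ker φ` for `i ≥ 2` (`mkFinCons` twice, through a complement of `K v` inside `ker φ`) —
and the basis-to-basis isomorphism `B.equiv B'` carries `(v, φ)` to `(v', φ')`.  (This is the elementary «`GL_n` acts transitively
on pairs (vector, covector) with prescribed pairing», e.g. [Dieudonne1971GroupesClassiques, Chap. II §1 n° 2–3] (transitivity of
`GL_n` and of its affine subgroups on vectors and hyperplanes); for `N = 1` and `b = 0` the level set is empty.)

USE (cell `hodgecm-mathlib`, FLOOR-0 P4, ENGINE E-2 child `Cruxes/H413/Lines/F0_E2SiegelWeilWeilRange.lean`, stub `stub_SW2_siegelWeil`,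
identity road (W), piece G2-SPLIT of F0P2a-p08 (g4)'s census 2764d66b §GAPS (G2), F0P4-plan (g3) 01:23:54Z): at a finite place `v` of
`F` SPLIT in `E`, `U(V)(F_v) ≅ GL_N(F_v)` and the hermitian form becomes the split pairing `(x, y) ↦ x ⬝ᵥ y` on `F_vᴺ × F_vᴺ`, so
Weil's hypothesis «`G'_v` opère transitivement sur `U(i)_v` quel que soit `i`» ([Weil1965, n° 52 Thm. 5]) at the auxiliary split
place is this file with `K = F_v`, `N = 3` — the input of I-UNIQ (`GL_N(F_v) ↷ U(b)_v` homogeneous) and of I-SPLIT (v).  HC_CM is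
proved only modulo the printed citations until rung 0 closes.

## References
* [Dieudonne1971GroupesClassiques] J. Dieudonné, *La géométrie des groupes classiques*, 3e éd. (1971), Chap. II §1 n° 2–3.
* [Weil1965] A. Weil, Acta Math. 113 (1965) 1–87, n° 52 Thm. 5 (the transitivity hypothesis at one place).
-/

set_option autoImplicit false

noncomputable section

namespace Literature.NumberTheory.Automorphic.GLnDotProduct

open Module Matrix

/-! ## §1 Coordinate-free: `GL(V)` is transitive on `{(v, φ) : φ v = b, v ≠ 0, φ ≠ 0}` -/

section Abstract

variable {K : Type*} [Field K] {V : Type*} [AddCommGroup V] [Module K V] [FiniteDimensional K V]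

/-- **shape basis, case `φ v ≠ 0`**: a basis with `B 0 = v` and all other vectors in `ker φ` (`mkFinCons v` over a basis of the
hyperplane `ker φ`). [cite: Dieudonne1971GroupesClassiques, Chap. II §1 n° 2–3] -/
theorem exists_basis_head_eq_of_apply_ne_zero {k : ℕ} (hk : finrank K V = k + 1) {φ : Module.Dual K V} {v : V}
    (hv : φ v ≠ 0) : ∃ B : Basis (Fin (k + 1)) K V, B 0 = v ∧ ∀ i : Fin k, φ (B i.succ) = 0 := by
  have hφ : φ ≠ 0 := fun h => hv (by rw [h, LinearMap.zero_apply])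
  have hker : finrank K (LinearMap.ker φ) = k := by
    have h := Module.Dual.finrank_ker_add_one_of_ne_zero hφ
    omega
  let c := Module.finBasisOfFinrankEq K (LinearMap.ker φ) hker
  have hli : ∀ (a : K), ∀ x ∈ LinearMap.ker φ, a • v + x = 0 → a = 0 := by
    intro a x hx h
    have h' := congrArg φ h
    rw [map_add, map_smul, (LinearMap.mem_ker).1 hx, add_zero, map_zero, smul_eq_mul] at h'
    exact (mul_eq_zero.1 h').resolve_right hv
  have hsp : ∀ z : V, ∃ a : K, z + a • v ∈ LinearMap.ker φ := fun z =>
    ⟨-(φ z / φ v), by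
      rw [LinearMap.mem_ker, map_add, map_smul, smul_eq_mul, neg_mul, div_mul_cancel₀ _ hv, add_neg_cancel]⟩
  refine ⟨Basis.mkFinCons v c hli hsp, ?_, fun i => ?_⟩
  · change (⇑(Basis.mkFinCons v c hli hsp)) 0 = v
    rw [Basis.coe_mkFinCons]
    rfl
  · change φ ((⇑(Basis.mkFinCons v c hli hsp)) i.succ) = 0
    rw [Basis.coe_mkFinCons, Fin.cons_succ, Function.comp_apply]
    exact (LinearMap.mem_ker).1 (c i).2

/-- **shape basis, case `φ v = 0`** (`v ≠ 0`, `φ ≠ 0`, `dim V ≥ 2`): a basis with `φ (B 0) = 1`, `B 1 = v`, and `B i ∈ ker φ`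
for `i ≥ 2` (`mkFinCons` over a basis of `ker φ` that starts with `v`). [cite: Dieudonne1971GroupesClassiques, Chap. II §1 n° 2–3] -/
theorem exists_basis_of_apply_eq_zero {k : ℕ} (hk : finrank K V = k + 2) {φ : Module.Dual K V} {v : V} (hφ : φ ≠ 0)
    (hv0 : v ≠ 0) (hv : φ v = 0) :
    ∃ B : Basis (Fin (k + 2)) K V, φ (B 0) = 1 ∧ B 1 = v ∧ ∀ i : Fin k, φ (B i.succ.succ) = 0 := by
  -- the hyperplane `W = ker φ` and the line `K v` inside it
  set W : Submodule K V := LinearMap.ker φ with hW_def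
  have hWk : finrank K W = k + 1 := by
    have h := Module.Dual.finrank_ker_add_one_of_ne_zero hφ
    rw [← hW_def] at h
    omega
  let v' : W := ⟨v, (LinearMap.mem_ker).2 hv⟩
  have hv'0 : v' ≠ 0 := fun h => hv0 (congrArg Subtype.val h)
  obtain ⟨q, hpq⟩ := Submodule.exists_isCompl (K ∙ v' : Submodule K W)
  have hq : finrank K q = k := by
    have h := Submodule.finrank_add_eq_of_isCompl hpq
    rw [finrank_span_singleton hv'0, hWk] at h
    omega
  let cq := Module.finBasisOfFinrankEq K q hq
  -- a basis of `W` with head `v'`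
  have hli₁ : ∀ (a : K), ∀ x ∈ q, a • v' + x = 0 → a = 0 := by
    intro a x hx h
    have hav : a • v' ∈ (K ∙ v' : Submodule K W) := Submodule.smul_mem _ a (Submodule.mem_span_singleton_self v')
    have hax : a • v' = -x := eq_neg_of_add_eq_zero_left h
    have hmem : a • v' ∈ (K ∙ v' : Submodule K W) ⊓ q := ⟨hav, by rw [hax]; exact q.neg_mem hx⟩
    rw [hpq.inf_eq_bot, Submodule.mem_bot] at hmem
    exact (smul_eq_zero.1 hmem).resolve_right hv'0
  have hsp₁ : ∀ z : W, ∃ a : K, z + a • v' ∈ q := by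
    intro z
    have hz : z ∈ (K ∙ v' : Submodule K W) ⊔ q := by rw [hpq.sup_eq_top]; exact Submodule.mem_top
    obtain ⟨y, hy, w, hw, hyw⟩ := Submodule.mem_sup.1 hz
    obtain ⟨t, rfl⟩ := Submodule.mem_span_singleton.1 hy
    refine ⟨-t, ?_⟩
    rw [← hyw, neg_smul, add_neg_cancel_comm]
    exact hw
  let bW : Basis (Fin (k + 1)) K W := Basis.mkFinCons v' cq hli₁ hsp₁
  have hbW0 : (bW 0 : V) = v := by
    change ((⇑(Basis.mkFinCons v' cq hli₁ hsp₁)) 0 : V) = v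
    rw [Basis.coe_mkFinCons]
    rfl
  -- a vector with `φ w₀ = 1`
  obtain ⟨u, hu⟩ : ∃ u : V, φ u ≠ 0 := by
    by_contra h
    exact hφ (LinearMap.ext fun u => by
      rw [LinearMap.zero_apply]
      exact not_not.1 fun hu => h ⟨u, hu⟩)
  set w₀ : V := (φ u)⁻¹ • u with hw₀_def
  have hw₀ : φ w₀ = 1 := by rw [hw₀_def, map_smul, smul_eq_mul, inv_mul_cancel₀ hu]
  -- the outer basis
  have hli₂ : ∀ (a : K), ∀ x ∈ W, a • w₀ + x = 0 → a = 0 := by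
    intro a x hx h
    have h' := congrArg φ h
    rw [map_add, map_smul, (LinearMap.mem_ker).1 hx, add_zero, map_zero, smul_eq_mul, hw₀, mul_one] at h'
    exact h'
  have hsp₂ : ∀ z : V, ∃ a : K, z + a • w₀ ∈ W := fun z =>
    ⟨-φ z, by rw [hW_def, LinearMap.mem_ker, map_add, map_smul, smul_eq_mul, hw₀, mul_one, add_neg_cancel]⟩
  refine ⟨Basis.mkFinCons w₀ bW hli₂ hsp₂, ?_, ?_, fun i => ?_⟩
  · change φ ((⇑(Basis.mkFinCons w₀ bW hli₂ hsp₂)) 0) = 1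
    rw [Basis.coe_mkFinCons]
    exact hw₀
  · change (⇑(Basis.mkFinCons w₀ bW hli₂ hsp₂)) (Fin.succ 0) = v
    rw [Basis.coe_mkFinCons, Fin.cons_succ, Function.comp_apply, hbW0]
  · change φ ((⇑(Basis.mkFinCons w₀ bW hli₂ hsp₂)) i.succ.succ) = 0
    rw [Basis.coe_mkFinCons, Fin.cons_succ, Function.comp_apply]
    exact (LinearMap.mem_ker).1 (bW i.succ).2

/-- **`GL(V)` is transitive on `{(v, φ) ∈ V × V^* : φ v = b, v ≠ 0, φ ≠ 0}`** for `dim V ≥ 2` and every `b` (incl. `0`): there is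
`g ∈ GL(V)` with `g v = v'` and `φ' ∘ g = φ` (i.e. `φ' = φ ∘ g⁻¹`). [cite: Dieudonne1971GroupesClassiques, Chap. II §1 n° 2–3] -/
theorem exists_linearEquiv_apply_eq_and_dual_comp_eq (h2 : 2 ≤ finrank K V) {v v' : V} {φ φ' : Module.Dual K V}
    (hv : v ≠ 0) (hv' : v' ≠ 0) (hφ : φ ≠ 0) (hφ' : φ' ≠ 0) (h : φ v = φ' v') :
    ∃ g : V ≃ₗ[K] V, g v = v' ∧ φ'.comp (g : V →ₗ[K] V) = φ := by
  obtain ⟨k, hk⟩ : ∃ k : ℕ, finrank K V = k + 2 := ⟨finrank K V - 2, by omega⟩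
  by_cases hb : φ v = 0
  · -- `b = 0`
    have hb' : φ' v' = 0 := h ▸ hb
    obtain ⟨B, hB0, hB1, hB⟩ := exists_basis_of_apply_eq_zero hk hφ hv hb
    obtain ⟨B', hB0', hB1', hB'⟩ := exists_basis_of_apply_eq_zero hk hφ' hv' hb'
    refine ⟨B.equiv B' (Equiv.refl _), ?_, B.ext fun i => ?_⟩
    · rw [← hB1, Basis.equiv_apply, Equiv.refl_apply, hB1']
    · rw [LinearMap.comp_apply, LinearEquiv.coe_coe, Basis.equiv_apply, Equiv.refl_apply]
      rcases Fin.eq_zero_or_eq_succ i with rfl | ⟨j, rfl⟩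
      · rw [hB0', hB0]
      · rcases Fin.eq_zero_or_eq_succ j with rfl | ⟨l, rfl⟩
        · rw [Fin.succ_zero_eq_one, hB1', hB1, hb, hb']
        · rw [hB' l, hB l]
  · -- `b ≠ 0`
    have hbv' : φ' v' ≠ 0 := h ▸ hb
    obtain ⟨B, hB0, hB⟩ := exists_basis_head_eq_of_apply_ne_zero (k := k + 1) hk hb
    obtain ⟨B', hB0', hB'⟩ := exists_basis_head_eq_of_apply_ne_zero (k := k + 1) hk hbv'
    refine ⟨B.equiv B' (Equiv.refl _), ?_, B.ext fun i => ?_⟩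
    · rw [← hB0, Basis.equiv_apply, Equiv.refl_apply, hB0']
    · rw [LinearMap.comp_apply, LinearEquiv.coe_coe, Basis.equiv_apply, Equiv.refl_apply]
      rcases Fin.eq_zero_or_eq_succ i with rfl | ⟨j, rfl⟩
      · rw [hB0', hB0, h]
      · rw [hB' j, hB j]

end Abstract

/-! ## §2 Matrices: `GL n K` on `Kⁿ × Kⁿ` by `(x, y) ↦ (g x, g⁻ᵀ y)` -/

section Matrices

variable {K : Type*} [Field K] {n : Type*} [Fintype n] [DecidableEq n]

/-- **the twisted action preserves the pairing**: `(g x) ⬝ᵥ ((g⁻¹)ᵀ y) = x ⬝ᵥ y`. [cite: Weil1965, n° 52 Thm. 5] -/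
theorem dotProduct_mulVec_transpose_inv_mulVec (g : GL n K) (x y : n → K) :
    ((g : Matrix n n K) *ᵥ x) ⬝ᵥ ((((g⁻¹ : GL n K) : Matrix n n K))ᵀ *ᵥ y) = x ⬝ᵥ y := by
  rw [Matrix.dotProduct_mulVec, Matrix.vecMul_transpose, Matrix.mulVec_mulVec, ← Units.val_mul, inv_mul_cancel,
    Units.val_one, Matrix.one_mulVec]

omit [DecidableEq n] in
/-- the functional `z ↦ y ⬝ᵥ z` as a sum of coordinate projections (kept def-free). [folklore] -/
private theorem sum_smul_proj_apply (y z : n → K) :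
    (∑ i, y i • (LinearMap.proj i : (n → K) →ₗ[K] K)) z = y ⬝ᵥ z := by
  rw [LinearMap.sum_apply]
  simp only [LinearMap.smul_apply, LinearMap.proj_apply, smul_eq_mul, dotProduct]

/-- the functional `z ↦ y ⬝ᵥ z` is non-zero when `y ≠ 0`. [folklore] -/
private theorem sum_smul_proj_ne_zero {y : n → K} (hy : y ≠ 0) :
    (∑ i, y i • (LinearMap.proj i : (n → K) →ₗ[K] K)) ≠ 0 := by
  intro h
  apply hy
  funext i
  have hi := congrArg (fun f : (n → K) →ₗ[K] K => f (Pi.single i 1)) h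
  simp only [sum_smul_proj_apply, dotProduct_single_one, LinearMap.zero_apply] at hi
  exact hi

/-- the unit of `Mₙ(K)` attached to a linear automorphism of `Kⁿ` (matrices of `g` and `g⁻¹`). [folklore] -/
private theorem exists_gl_coe_eq_toMatrix' (g : (n → K) ≃ₗ[K] (n → K)) :
    ∃ u : GL n K, (u : Matrix n n K) = LinearMap.toMatrix' (g : (n → K) →ₗ[K] (n → K)) := by
  refine ⟨⟨LinearMap.toMatrix' (g : (n → K) →ₗ[K] (n → K)), LinearMap.toMatrix' (g.symm : (n → K) →ₗ[K] (n → K)), ?_, ?_⟩, rfl⟩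
  · rw [← LinearMap.toMatrix'_comp, ← LinearMap.toMatrix'_id]
    congr 1
    exact LinearMap.ext fun z => g.apply_symm_apply z
  · rw [← LinearMap.toMatrix'_comp, ← LinearMap.toMatrix'_id]
    congr 1
    exact LinearMap.ext fun z => g.symm_apply_apply z

omit [DecidableEq n] in
/-- `(Mᵀ *ᵥ y) j = y ⬝ᵥ (M *ᵥ e_j)` — the `j`-th entry of `Mᵀ y` is the pairing of `y` with the `j`-th column. [folklore] -/
private theorem transpose_mulVec_apply_eq_dotProduct_col [DecidableEq n] (M : Matrix n n K) (y : n → K) (j : n) :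
    (Mᵀ *ᵥ y) j = y ⬝ᵥ (M *ᵥ Pi.single j 1) := by
  rw [← Matrix.vecMul_transpose, Matrix.mulVec_single_one]
  simp only [Matrix.vecMul, dotProduct, Matrix.transpose_apply, Matrix.col_apply, mul_comm]

/-- **`GL_N(K)` IS TRANSITIVE ON `{(x, y) : x ⬝ᵥ y = b, x ≠ 0, y ≠ 0}` for `N ≥ 2` and every `b`** (the action
`(x, y) ↦ (g x, (g⁻¹)ᵀ y)`): given two such pairs with the same pairing there is `g ∈ GL n K` with `g x = x'` and `(g⁻¹)ᵀ y = y'`.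
[cite: Dieudonne1971GroupesClassiques, Chap. II §1 n° 2–3] [cite: Weil1965, n° 52 Thm. 5] -/
theorem exists_gl_mulVec_eq_and_transpose_inv_mulVec_eq (h2 : 2 ≤ Fintype.card n) {x y x' y' : n → K} (hx : x ≠ 0)
    (hy : y ≠ 0) (hx' : x' ≠ 0) (hy' : y' ≠ 0) (h : x ⬝ᵥ y = x' ⬝ᵥ y') :
    ∃ g : GL n K, (g : Matrix n n K) *ᵥ x = x' ∧ (((g⁻¹ : GL n K) : Matrix n n K))ᵀ *ᵥ y = y' := by
  -- the two covectors
  set φ : Module.Dual K (n → K) := ∑ i, y i • (LinearMap.proj i : (n → K) →ₗ[K] K) with hφ_def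
  set φ' : Module.Dual K (n → K) := ∑ i, y' i • (LinearMap.proj i : (n → K) →ₗ[K] K) with hφ'_def
  have hφ : φ ≠ 0 := sum_smul_proj_ne_zero hy
  have hφ' : φ' ≠ 0 := sum_smul_proj_ne_zero hy'
  have hrank : 2 ≤ finrank K (n → K) := by rw [Module.finrank_fintype_fun_eq_card]; exact h2
  have hval : φ x = φ' x' := by rw [sum_smul_proj_apply, sum_smul_proj_apply, dotProduct_comm y x, dotProduct_comm y' x', h]
  obtain ⟨g, hgx, hgφ⟩ := exists_linearEquiv_apply_eq_and_dual_comp_eq hrank hx hx' hφ hφ' hval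
  obtain ⟨u, hu⟩ := exists_gl_coe_eq_toMatrix' g
  -- `u x = x'`
  have hux : (u : Matrix n n K) *ᵥ x = x' := by rw [hu, LinearMap.toMatrix'_mulVec, LinearEquiv.coe_coe, hgx]
  -- `uᵀ y' = y`
  have huy : ((u : Matrix n n K))ᵀ *ᵥ y' = y := by
    funext j
    rw [transpose_mulVec_apply_eq_dotProduct_col, hu, LinearMap.toMatrix'_mulVec, LinearEquiv.coe_coe,
      ← sum_smul_proj_apply y', ← hφ'_def]
    have hj := DFunLike.congr_fun hgφ (Pi.single j 1)
    rw [LinearMap.comp_apply, LinearEquiv.coe_coe] at hj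
    rw [hj, sum_smul_proj_apply, dotProduct_single_one]
  refine ⟨u, hux, ?_⟩
  -- `(u⁻¹)ᵀ y = (u⁻¹)ᵀ (uᵀ y') = y'`
  rw [← huy, Matrix.mulVec_mulVec, ← Matrix.transpose_mul, ← Units.val_mul, mul_inv_cancel, Units.val_one,
    Matrix.transpose_one, Matrix.one_mulVec]

/-- the same with the level `b` displayed. [cite: Weil1965, n° 52 Thm. 5] -/
theorem exists_gl_mulVec_eq_and_transpose_inv_mulVec_eq_of_dotProduct_eq (h2 : 2 ≤ Fintype.card n) {b : K}
    {x y x' y' : n → K} (hx : x ≠ 0) (hy : y ≠ 0) (hx' : x' ≠ 0) (hy' : y' ≠ 0) (hxy : x ⬝ᵥ y = b) (hxy' : x' ⬝ᵥ y' = b) :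
    ∃ g : GL n K, (g : Matrix n n K) *ᵥ x = x' ∧ (((g⁻¹ : GL n K) : Matrix n n K))ᵀ *ᵥ y = y' :=
  exists_gl_mulVec_eq_and_transpose_inv_mulVec_eq h2 hx hy hx' hy' (hxy.trans hxy'.symm)

/-- **orbit form**: `(x', y')` lies in the `GL n K`-orbit of `(x, y)` under `(x, y) ↦ (g x, (g⁻¹)ᵀ y)` iff `x' ≠ 0`, `y' ≠ 0` and
`x' ⬝ᵥ y' = x ⬝ᵥ y` (for `x, y ≠ 0`, `N ≥ 2`). [cite: Dieudonne1971GroupesClassiques, Chap. II §1 n° 2–3] [cite: Weil1965, n° 52 Thm. 5] -/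
theorem exists_gl_mulVec_eq_and_transpose_inv_mulVec_eq_iff (h2 : 2 ≤ Fintype.card n) {x y x' y' : n → K} (hx : x ≠ 0)
    (hy : y ≠ 0) :
    (∃ g : GL n K, (g : Matrix n n K) *ᵥ x = x' ∧ (((g⁻¹ : GL n K) : Matrix n n K))ᵀ *ᵥ y = y') ↔
      x' ≠ 0 ∧ y' ≠ 0 ∧ x' ⬝ᵥ y' = x ⬝ᵥ y := by
  constructor
  · rintro ⟨g, rfl, rfl⟩
    refine ⟨fun h0 => hx ?_, fun h0 => hy ?_, dotProduct_mulVec_transpose_inv_mulVec g x y⟩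
    · have h := congrArg (fun v => ((g⁻¹ : GL n K) : Matrix n n K) *ᵥ v) h0
      simpa only [Matrix.mulVec_mulVec, ← Units.val_mul, inv_mul_cancel, Units.val_one, Matrix.one_mulVec,
        Matrix.mulVec_zero] using h
    · have h := congrArg (fun v => ((g : GL n K) : Matrix n n K)ᵀ *ᵥ v) h0
      simpa only [Matrix.mulVec_mulVec, ← Matrix.transpose_mul, ← Units.val_mul, inv_mul_cancel, Units.val_one,
        Matrix.transpose_one, Matrix.one_mulVec, Matrix.mulVec_zero] using h
  · rintro ⟨hx', hy', h⟩
    exact exists_gl_mulVec_eq_and_transpose_inv_mulVec_eq h2 hx hy hx' hy' h.symm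

end Matrices

end Literature.NumberTheory.Automorphic.GLnDotProduct
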